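import Mathlib
import Summits.AtomisticToContinuum.HydrodynamicLimit.Theorems.ImplosionDichotomyDenseExcursionCavityNegExpVolterra

/-!
# The Volterra fixed point of the smooth branch with UNIFORM radius and a priori bounds (vector-valued regular row)
# (crux `DenseExcursion`, line `sonic-cavity-renewal`, brick for stub `stub_cavityResolventCk`, theorem T7(i))

Helper file (`--supports stmt-AtomisticToContinuum-12586`, line lead a2, stub-worker E2 for `stub_cavityResolventCk`).
Quantitative form of `res_volterra_fixed_point` / `negexp_volterra_fixed_point` (registered helper
`res_volterra_uniform`): for a complex Banach space `E` and BOUNDS `M, μ₀, A, B, D` there are a radius `0 < δ ≤ 1` and a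
constant `K`, depending ONLY on the bounds, such that for every weight exponent `a` (`Re a ≥ 0`), every continuous
nowhere-vanishing `μ` with `μ₀ ≤ ‖μ‖ ≤ M` on `[−1, 1]` and all continuous operator fields `a₁₂ : ℝ → (E →L[ℂ] ℂ)`,
`a₂₁ : ℝ → (ℂ →L[ℂ] E)`, `a₂₂ : ℝ → (E →L[ℂ] E)` bounded by `A, B, D` on `[−1, 1]`:

* (EXISTENCE) for all continuous sources `b₁, b₂` and every `c₀ : E` there are continuous `u : ℝ → ℂ`, `c : ℝ → E` with
  `u(R) = μ(R) ∫₀¹ t^a ((a₁₂ c + b₁)/μ)(Rt) dt` (all `R`) and `c(R) = c₀ + ∫₀ᴿ (a₂₁ u + a₂₂ c + b₂)` (`|R| ≤ δ`);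
* (A PRIORI BOUND) every pair `(u, c)` continuous on `[−R₀, R₀]`, `R₀ ≤ δ`, satisfying the two integral equations there
  obeys `‖u‖, ‖c‖ ≤ K(‖c₀‖ + N)` on `[−R₀, R₀]` whenever `‖b₁‖, ‖b₂‖ ≤ N` on `[−R₀, R₀]` — in particular (linearity)
  continuous solutions are UNIQUE on every `[−R₀, R₀]`, and the bound only sees the sources on `[−R₀, R₀]` (causality).

This is the common quantitative core of the centre branch (`(α)`: weighted sup bound of the particular solution,
uniform on `‖Λ‖ ≤ R`), of the smooth branch at the sonic point after the reduction of the jet resonances by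
differentiation (`…CavityResDescent`), and of the continuity in `Λ` of both (difference trick), i.e. of theorem T7(i).
Proof: `c ↦ Φ(c)` is a `1/2`-contraction of `C([−δ, δ], E)` for `δ(B M A/μ₀ + D) ≤ 1/2` (existence, verbatim
`res_volterra_fixed_point`); the a priori bound is `m ≤ ‖Φ(0)‖ + m/2` at a maximum point of `‖c‖`.
Sources: folklore (Volterra integral equations; Coddington–Levinson 1955 Ch. 4 §2).
-/

noncomputable section

open Set Filter MeasureTheory intervalIntegral
open scoped Topology NNReal

namespace Summit.AtomisticToContinuum.HydrodynamicLimit.Theorems.SonicCavityRenewal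

/-- POINTWISE ESTIMATE OF THE EULER PART: if `‖(a₁₂(c) + b₁)/μ‖ ≤ m` on `|s| ≤ |R|` and `‖μ R‖ ≤ M` then
`‖μ(R) ∫₀¹ t^a ((a₁₂ c + b₁)/μ)(Rt) dt‖ ≤ M m` (`Re a ≥ 0`). [folklore] -/
theorem norm_volterraK_le {E : Type*} [NormedAddCommGroup E] [NormedSpace ℂ E] {a : ℂ} (ha : 0 ≤ a.re) {μ : ℝ → ℂ}
    {a₁₂ : ℝ → E →L[ℂ] ℂ} {b₁ : ℝ → ℂ} {c : ℝ → E} {R M m : ℝ} (hM : ‖μ R‖ ≤ M)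
    (h : ∀ s, |s| ≤ |R| → ‖(a₁₂ s (c s) + b₁ s) / μ s‖ ≤ m) :
    ‖μ R * ∫ t in (0 : ℝ)..1, (t : ℂ) ^ a * ((a₁₂ (R * t) (c (R * t)) + b₁ (R * t)) / μ (R * t))‖ ≤ M * m := by
  rw [norm_mul]
  exact mul_le_mul hM (norm_eulerCpow_le ha (g := fun s => (a₁₂ s (c s) + b₁ s) / μ s) h) (norm_nonneg _)
    ((norm_nonneg _).trans hM)

/-- **Registered helper `res_volterra_uniform`: THE VOLTERRA FIXED POINT WITH UNIFORM RADIUS AND A PRIORI BOUNDS.** See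
the module docstring. [folklore] -/
theorem res_volterra_uniform : ∀ (E : Type) [NormedAddCommGroup E] [NormedSpace ℂ E] [CompleteSpace E] (M μ₀ A B D : ℝ), 0 < μ₀ → 0 ≤ M → 0 ≤ A → 0 ≤ B → 0 ≤ D → ∃ δ : ℝ, 0 < δ ∧ δ ≤ 1 ∧ ∃ K : ℝ, 0 ≤ K ∧ ∀ (a : ℂ) (μ : ℝ → ℂ) (a₁₂ : ℝ → E →L[ℂ] ℂ) (a₂₁ : ℝ → ℂ →L[ℂ] E) (a₂₂ : ℝ → E →L[ℂ] E), 0 ≤ a.re → Continuous μ → (∀ R, μ R ≠ 0) → Continuous a₁₂ → Continuous a₂₁ → Continuous a₂₂ → (∀ s ∈ Set.Icc (-1 : ℝ) 1, ‖μ s‖ ≤ M ∧ μ₀ ≤ ‖μ s‖ ∧ ‖a₁₂ s‖ ≤ A ∧ ‖a₂₁ s‖ ≤ B ∧ ‖a₂₂ s‖ ≤ D) → ∀ (b₁ : ℝ → ℂ) (b₂ : ℝ → E), Continuous b₁ → Continuous b₂ → ∀ c₀ : E, (∃ (u : ℝ → ℂ) (c : ℝ → E), Continuous u ∧ Continuous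 c ∧ (∀ R, u R = μ R * ∫ t in (0 : ℝ)..1, (t : ℂ) ^ a * ((a₁₂ (R * t) (c (R * t)) + b₁ (R * t)) / μ (R * t))) ∧ (∀ R ∈ Set.Icc (-δ) δ, c R = c₀ + ∫ s in (0 : ℝ)..R, (a₂₁ s (u s) + a₂₂ s (c s) + b₂ s))) ∧ (∀ (u : ℝ → ℂ) (c : ℝ → E) (R₀ N : ℝ), 0 ≤ R₀ → R₀ ≤ δ → ContinuousOn u (Set.Icc (-R₀) R₀) → ContinuousOn c (Set.Icc (-R₀) R₀) → (∀ R ∈ Set.Icc (-R₀) R₀, u R = μ R * ∫ t in (0 : ℝ)..1, (t : ℂ) ^ a * ((a₁₂ (R * t) (c (R * t)) + b₁ (R * t)) / μ (R * t))) → (∀ R ∈ Set.Icc (-R₀) R₀, c R = c₀ + ∫ s in (0 : ℝ)..R, (a₂₁ s (u s) + a₂₂ s (c s) + b₂ s)) → (∀ s ∈ Set.Icc (-R₀) R₀, ‖b₁ s‖ ≤ N ∧ ‖b₂ s‖ ≤ N) → ∀ R ∈ Set.Icc (-R₀) R₀, ‖u R‖ ≤ K * (‖c₀‖ + N) ∧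 ‖c R‖ ≤ K * (‖c₀‖ + N)) := by
  intro E _ _ _ M μ₀ A B D hμ₀ hM0 hA0 hB0 hD0
  -- Lipschitz constant of `c ↦ K c` and the radius
  set L₁ : ℝ := M * (A / μ₀) with hL₁
  have hL₁0 : 0 ≤ L₁ := by positivity
  set δ : ℝ := min 1 (1 / (2 * (B * L₁ + D) + 2)) with hδ
  have hδpos : 0 < δ := lt_min one_pos (by positivity)
  have hδ1 : δ ≤ 1 := min_le_left _ _
  have hδL : δ * (B * L₁ + D) ≤ 1 / 2 := by
    have h1 : δ ≤ 1 / (2 * (B * L₁ + D) + 2) := min_le_right _ _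
    have h2 : 0 < 2 * (B * L₁ + D) + 2 := by positivity
    have h3 : δ * (2 * (B * L₁ + D) + 2) ≤ 1 := by
      rw [le_div_iff₀ h2] at h1; exact h1
    nlinarith [mul_nonneg hδpos.le (by positivity : (0 : ℝ) ≤ B * L₁ + D)]
  -- the a priori constant
  set Kc : ℝ := 2 + 2 * (B * (M / μ₀) + 1) with hKc
  set K : ℝ := Kc + M * (A * Kc + 1) / μ₀ with hK
  have hKc0 : 0 ≤ Kc := by positivity
  have hK0 : 0 ≤ K := by positivity
  have hKcK : Kc ≤ K := by rw [hK]; linarith [show 0 ≤ M * (A * Kc + 1) / μ₀ by positivity]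
  refine ⟨δ, hδpos, hδ1, K, hK0, fun a μ a₁₂ a₂₁ a₂₂ ha hμ hμ0 ha₁₂ ha₂₁ ha₂₂ hbd b₁ b₂ hb₁ hb₂ c₀ => ⟨?_, ?_⟩⟩
  · -- EXISTENCE (verbatim `res_volterra_fixed_point`, with the given bounds)
    have hI : (-δ : ℝ) ≤ δ := by linarith
    haveI : CompactSpace (Icc (-δ) δ) := isCompact_iff_compactSpace.1 isCompact_Icc
    haveI : Nonempty (Icc (-δ) δ) := ⟨⟨0, by constructor <;> linarith⟩⟩
    let ext : C(Icc (-δ) δ, E) → ℝ → E := fun c => IccExtend hI c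
    let Kf : C(Icc (-δ) δ, E) → ℝ → ℂ := fun c R =>
      μ R * ∫ t in (0 : ℝ)..1, (t : ℂ) ^ a * ((a₁₂ (R * t) (ext c (R * t)) + b₁ (R * t)) / μ (R * t))
    let Pf : C(Icc (-δ) δ, E) → ℝ → E := fun c R =>
      c₀ + ∫ s in (0 : ℝ)..R, (a₂₁ s (Kf c s) + a₂₂ s (ext c s) + b₂ s)
    have hext : ∀ c, Continuous (ext c) := fun c => c.continuous.Icc_extend'
    have hinner : ∀ c, Continuous fun s => (a₁₂ s (ext c s) + b₁ s) / μ s := fun c =>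
      ((ha₁₂.clm_apply (hext c)).add hb₁).div hμ hμ0
    have hKc' : ∀ c, Continuous (Kf c) := fun c => hμ.mul (continuous_eulerCpow ha (hinner c))
    have hPi : ∀ c, Continuous fun s => a₂₁ s (Kf c s) + a₂₂ s (ext c s) + b₂ s := fun c =>
      ((ha₂₁.clm_apply (hKc' c)).add (ha₂₂.clm_apply (hext c))).add hb₂
    have hPc : ∀ c, Continuous (Pf c) := fun c =>
      continuous_const.add (intervalIntegral.continuous_primitive (fun a b => (hPi c).intervalIntegrable a b) 0)
    let Φ : C(Icc (-δ) δ, E) → C(Icc (-δ) δ, E) := fun c => ⟨fun R => Pf c R, (hPc c).comp continuous_subtype_val⟩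
    have hextd : ∀ (c c' : C(Icc (-δ) δ, E)) (s : ℝ), ‖ext c s - ext c' s‖ ≤ dist c c' := by
      intro c c' s
      simp only [ext, IccExtend, Function.comp_apply, ← dist_eq_norm]
      exact ContinuousMap.dist_apply_le_dist _
    have hmemI : ∀ {s : ℝ}, |s| ≤ δ → s ∈ Icc (-1 : ℝ) 1 := fun hs =>
      ⟨by linarith [(abs_le.1 hs).1], by linarith [(abs_le.1 hs).2]⟩
    have hKd : ∀ (c c' : C(Icc (-δ) δ, E)) (R : ℝ), |R| ≤ δ → ‖Kf c R - Kf c' R‖ ≤ L₁ * dist c c' := by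
      intro c c' R hR
      have hRI := hmemI hR
      have hi : ∀ c : C(Icc (-δ) δ, E), IntervalIntegrable (fun t : ℝ =>
          (t : ℂ) ^ a * ((a₁₂ (R * t) (ext c (R * t)) + b₁ (R * t)) / μ (R * t))) volume 0 1 := fun c =>
        intervalIntegrable_eulerCpow ha (hinner c) R
      have hdiff : Kf c R - Kf c' R = μ R * ∫ t in (0 : ℝ)..1, (t : ℂ) ^ a *
          ((a₁₂ (R * t) (ext c (R * t) - ext c' (R * t))) / μ (R * t)) := by
        have hsub := intervalIntegral.integral_sub (hi c) (hi c')
        have heq : (∫ t in (0 : ℝ)..1, ((t : ℂ) ^ a * ((a₁₂ (R * t) (ext c (R * t)) + b₁ (R * t)) / μ (R * t)) -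
            (t : ℂ) ^ a * ((a₁₂ (R * t) (ext c' (R * t)) + b₁ (R * t)) / μ (R * t)))) =
            ∫ t in (0 : ℝ)..1, (t : ℂ) ^ a * ((a₁₂ (R * t) (ext c (R * t) - ext c' (R * t))) / μ (R * t)) :=
          integral_congr fun t _ => by rw [map_sub]; ring
        simp only [Kf]
        rw [← mul_sub, ← hsub, heq]
      rw [hdiff, norm_mul]
      have hbound : ∀ s, |s| ≤ |R| → ‖(a₁₂ s (ext c s - ext c' s)) / μ s‖ ≤ A / μ₀ * dist c c' := by
        intro s hs
        obtain ⟨-, hμs, hAs, -, -⟩ := hbd s (hmemI (hs.trans hR))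
        rw [norm_div, div_eq_mul_inv]
        have h1 : ‖a₁₂ s (ext c s - ext c' s)‖ ≤ A * dist c c' :=
          (ContinuousLinearMap.le_opNorm _ _).trans (mul_le_mul hAs (hextd c c' s) (norm_nonneg _) hA0)
        have h3 : (‖μ s‖)⁻¹ ≤ μ₀⁻¹ := inv_anti₀ hμ₀ hμs
        calc ‖a₁₂ s (ext c s - ext c' s)‖ * (‖μ s‖)⁻¹ ≤ A * dist c c' * μ₀⁻¹ := by gcongr
          _ = A / μ₀ * dist c c' := by ring
      have hint := norm_eulerCpow_le ha (g := fun s => (a₁₂ s (ext c s - ext c' s)) / μ s) (R := R) hbound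
      calc ‖μ R‖ * ‖∫ t in (0 : ℝ)..1, (t : ℂ) ^ a * ((a₁₂ (R * t) (ext c (R * t) - ext c' (R * t))) / μ (R * t))‖
          ≤ M * (A / μ₀ * dist c c') := mul_le_mul (hbd R hRI).1 hint (norm_nonneg _) hM0
        _ = L₁ * dist c c' := by rw [hL₁]; ring
    have hPd : ∀ (c c' : C(Icc (-δ) δ, E)) (R : ℝ), |R| ≤ δ → ‖Pf c R - Pf c' R‖ ≤ 1 / 2 * dist c c' := by
      intro c c' R hR
      have hdiff : Pf c R - Pf c' R =
          ∫ s in (0 : ℝ)..R, (a₂₁ s (Kf c s - Kf c' s) + a₂₂ s (ext c s - ext c' s)) := by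
        simp only [Pf]
        rw [add_sub_add_left_eq_sub, ← intervalIntegral.integral_sub ((hPi c).intervalIntegrable _ _)
          ((hPi c').intervalIntegrable _ _)]
        refine integral_congr fun s _ => ?_
        simp only [map_sub]
        abel
      rw [hdiff]
      have hb : ∀ s ∈ Set.uIoc (0 : ℝ) R, ‖a₂₁ s (Kf c s - Kf c' s) + a₂₂ s (ext c s - ext c' s)‖ ≤
          (B * L₁ + D) * dist c c' := by
        intro s hs
        have hs' : |s| ≤ |R| := by
          rcases le_or_gt 0 R with h | h
          · rw [uIoc_of_le h] at hs
            rw [abs_of_nonneg hs.1.le, abs_of_nonneg h]; exact hs.2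
          · rw [uIoc_of_ge h.le] at hs
            rw [abs_of_nonpos hs.2, abs_of_neg h]; linarith [hs.1]
        have hsδ : |s| ≤ δ := hs'.trans hR
        obtain ⟨-, -, -, hBs, hDs⟩ := hbd s (hmemI hsδ)
        calc ‖a₂₁ s (Kf c s - Kf c' s) + a₂₂ s (ext c s - ext c' s)‖
            ≤ ‖a₂₁ s‖ * ‖Kf c s - Kf c' s‖ + ‖a₂₂ s‖ * ‖ext c s - ext c' s‖ :=
              (norm_add_le _ _).trans (add_le_add (ContinuousLinearMap.le_opNorm _ _) (ContinuousLinearMap.le_opNorm _ _))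
          _ ≤ B * (L₁ * dist c c') + D * dist c c' :=
              add_le_add (mul_le_mul hBs (hKd c c' s hsδ) (norm_nonneg _) hB0)
                (mul_le_mul hDs (hextd c c' s) (norm_nonneg _) hD0)
          _ = (B * L₁ + D) * dist c c' := by ring
      calc ‖∫ s in (0 : ℝ)..R, (a₂₁ s (Kf c s - Kf c' s) + a₂₂ s (ext c s - ext c' s))‖
          ≤ (B * L₁ + D) * dist c c' * |R - 0| := norm_integral_le_of_norm_le_const hb
        _ ≤ (B * L₁ + D) * dist c c' * δ := by
            rw [sub_zero]; exact mul_le_mul_of_nonneg_left hR (by positivity)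
        _ ≤ 1 / 2 * dist c c' := by nlinarith [hδL, dist_nonneg (x := c) (y := c')]
    have hΦ : ContractingWith (1 / 2 : ℝ≥0) Φ := by
      refine ⟨by norm_num, LipschitzWith.of_dist_le_mul fun c c' => ?_⟩
      rw [ContinuousMap.dist_le (by positivity)]
      rintro ⟨R, hR⟩
      have hR' : |R| ≤ δ := abs_le.2 hR
      have h := hPd c c' R hR'
      rw [dist_eq_norm]
      have e : ((1 / 2 : ℝ≥0) : ℝ) = 1 / 2 := by norm_num
      rw [e]
      exact h
    set cst := ContractingWith.fixedPoint Φ hΦ with hcst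
    have hfix : Φ cst = cst := hΦ.fixedPoint_isFixedPt
    have hcst : ∀ R (hR : R ∈ Icc (-δ) δ), cst ⟨R, hR⟩ = Pf cst R := fun R hR =>
      calc cst ⟨R, hR⟩ = (Φ cst) ⟨R, hR⟩ := by rw [hfix]
        _ = Pf cst R := rfl
    exact ⟨Kf cst, ext cst, hKc' cst, hext cst, fun R => rfl, fun R hR => (IccExtend_of_mem hI cst hR).trans (hcst R hR)⟩
  · -- THE A PRIORI BOUND on `[−R₀, R₀]`
    intro u c R₀ N hR₀ hR₀δ hu hc huI hcI hN
    have hcpt : IsCompact (Icc (-R₀) R₀) := isCompact_Icc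
    have h0I : (0 : ℝ) ∈ Icc (-R₀) R₀ := ⟨by linarith, hR₀⟩
    have hN0 : 0 ≤ N := (norm_nonneg _).trans (hN 0 h0I).1
    have hmemI : ∀ {s : ℝ}, |s| ≤ R₀ → s ∈ Icc (-1 : ℝ) 1 := fun hs =>
      ⟨by linarith [(abs_le.1 hs).1, hR₀δ.trans hδ1], by linarith [(abs_le.1 hs).2, hR₀δ.trans hδ1]⟩
    have habsI : ∀ {s : ℝ}, |s| ≤ R₀ ↔ s ∈ Icc (-R₀) R₀ := fun {s} => by rw [mem_Icc, abs_le]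
    -- a maximum point of `‖c‖`
    obtain ⟨s₀, hs₀, hmax⟩ := hcpt.exists_isMaxOn (nonempty_Icc.2 (by linarith)) (continuous_norm.comp_continuousOn hc)
    set m : ℝ := ‖c s₀‖ with hm
    have hm0 : 0 ≤ m := norm_nonneg _
    have hcm : ∀ s ∈ Icc (-R₀) R₀, ‖c s‖ ≤ m := fun s hs => hmax hs
    -- the `u`-bound in terms of `m`
    have hub : ∀ R ∈ Icc (-R₀) R₀, ‖u R‖ ≤ M * ((A * m + N) / μ₀) := by
      intro R hR
      rw [huI R hR]
      refine norm_volterraK_le ha (hbd R (hmemI (habsI.2 hR))).1 fun s hs => ?_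
      have hsR : s ∈ Icc (-R₀) R₀ := habsI.1 (hs.trans (habsI.2 hR))
      obtain ⟨-, hμs, hAs, -, -⟩ := hbd s (hmemI (habsI.2 hsR))
      rw [norm_div, div_le_div_iff₀ (lt_of_lt_of_le hμ₀ hμs) hμ₀]
      have h1 : ‖a₁₂ s (c s) + b₁ s‖ ≤ A * m + N := (norm_add_le _ _).trans (add_le_add
        ((ContinuousLinearMap.le_opNorm _ _).trans (mul_le_mul hAs (hcm s hsR) (norm_nonneg _) hA0)) (hN s hsR).1)
      calc ‖a₁₂ s (c s) + b₁ s‖ * μ₀ ≤ (A * m + N) * μ₀ := by gcongr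
        _ ≤ (A * m + N) * ‖μ s‖ := by gcongr
    -- the `c`-bound at the maximum point: `m ≤ ‖c₀‖ + R₀ (B·U + D·m + N) ≤ ‖c₀‖ + m/2 + …`
    have hcb : m ≤ ‖c₀‖ + R₀ * (B * (M * ((A * m + N) / μ₀)) + D * m + N) := by
      have hint : ‖∫ s in (0 : ℝ)..s₀, (a₂₁ s (u s) + a₂₂ s (c s) + b₂ s)‖ ≤
          (B * (M * ((A * m + N) / μ₀)) + D * m + N) * |s₀ - 0| := by
        refine norm_integral_le_of_norm_le_const fun s hs => ?_
        have hsR : s ∈ Icc (-R₀) R₀ := by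
          rcases le_or_gt 0 s₀ with h | h
          · rw [uIoc_of_le h] at hs; exact ⟨by linarith [hs.1], hs.2.trans hs₀.2⟩
          · rw [uIoc_of_ge h.le] at hs; exact ⟨lt_of_le_of_lt hs₀.1 hs.1 |>.le, by linarith [hs.2]⟩
        obtain ⟨-, -, -, hBs, hDs⟩ := hbd s (hmemI (habsI.2 hsR))
        calc ‖a₂₁ s (u s) + a₂₂ s (c s) + b₂ s‖ ≤ ‖a₂₁ s‖ * ‖u s‖ + ‖a₂₂ s‖ * ‖c s‖ + ‖b₂ s‖ :=
              (norm_add_le _ _).trans (add_le_add ((norm_add_le _ _).trans (add_le_add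
                (ContinuousLinearMap.le_opNorm _ _) (ContinuousLinearMap.le_opNorm _ _))) le_rfl)
          _ ≤ B * (M * ((A * m + N) / μ₀)) + D * m + N :=
              add_le_add (add_le_add (mul_le_mul hBs (hub s hsR) (norm_nonneg _) hB0)
                (mul_le_mul hDs (hcm s hsR) (norm_nonneg _) hD0)) (hN s hsR).2
      have hs₀abs : |s₀ - 0| ≤ R₀ := by rw [sub_zero]; exact habsI.2 hs₀
      calc m = ‖c s₀‖ := hm
        _ = ‖c₀ + ∫ s in (0 : ℝ)..s₀, (a₂₁ s (u s) + a₂₂ s (c s) + b₂ s)‖ := by rw [hcI s₀ hs₀]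
        _ ≤ ‖c₀‖ + (B * (M * ((A * m + N) / μ₀)) + D * m + N) * |s₀ - 0| := (norm_add_le _ _).trans (add_le_add le_rfl hint)
        _ ≤ ‖c₀‖ + (B * (M * ((A * m + N) / μ₀)) + D * m + N) * R₀ := by gcongr
        _ = ‖c₀‖ + R₀ * (B * (M * ((A * m + N) / μ₀)) + D * m + N) := by ring
    -- solve for `m`
    have hkey : R₀ * (B * (M * (A * m / μ₀)) + D * m) ≤ m / 2 := by
      have e : R₀ * (B * (M * (A * m / μ₀)) + D * m) = (R₀ * (B * L₁ + D)) * m := by rw [hL₁]; ring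
      rw [e]
      have : R₀ * (B * L₁ + D) ≤ 1 / 2 := (mul_le_mul_of_nonneg_right hR₀δ (by positivity)).trans hδL
      nlinarith
    have hsplit : R₀ * (B * (M * ((A * m + N) / μ₀)) + D * m + N) =
        R₀ * (B * (M * (A * m / μ₀)) + D * m) + R₀ * (B * (M * (N / μ₀)) + N) := by ring
    have hR₀1 : R₀ ≤ 1 := hR₀δ.trans hδ1
    have hrest : R₀ * (B * (M * (N / μ₀)) + N) ≤ (B * (M / μ₀) + 1) * N := by
      have : B * (M * (N / μ₀)) + N = (B * (M / μ₀) + 1) * N := by ring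
      rw [this]
      exact mul_le_of_le_one_left (by positivity) hR₀1
    have hmK : m ≤ Kc * (‖c₀‖ + N) := by
      have h1 : m ≤ ‖c₀‖ + m / 2 + (B * (M / μ₀) + 1) * N := by rw [hsplit] at hcb; linarith
      have h2 : m ≤ 2 * ‖c₀‖ + 2 * ((B * (M / μ₀) + 1) * N) := by linarith
      have h3 : 0 ≤ (B * (M / μ₀) + 1) * ‖c₀‖ := by positivity
      have e : Kc * (‖c₀‖ + N) = 2 * ‖c₀‖ + 2 * ((B * (M / μ₀) + 1) * N) + (2 * N + 2 * ((B * (M / μ₀) + 1) * ‖c₀‖)) := by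
        rw [hKc]; ring
      rw [e]
      linarith
    intro R hR
    have hu1 : ‖u R‖ ≤ K * (‖c₀‖ + N) := by
      calc ‖u R‖ ≤ M * ((A * m + N) / μ₀) := hub R hR
        _ ≤ M * ((A * (Kc * (‖c₀‖ + N)) + (‖c₀‖ + N)) / μ₀) := by
            gcongr
            linarith [norm_nonneg c₀]
        _ = (M * (A * Kc + 1) / μ₀) * (‖c₀‖ + N) := by ring
        _ ≤ K * (‖c₀‖ + N) := by
            rw [hK]; nlinarith [norm_nonneg c₀]
    exact ⟨hu1, (hcm R hR).trans (hmK.trans (mul_le_mul_of_nonneg_right hKcK (by positivity)))⟩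

end Summit.AtomisticToContinuum.HydrodynamicLimit.Theorems.SonicCavityRenewal

end
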